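/-
Copyright (c) 2026 the pub-hodgecm-mathlib formalisation cell (harness21).  Prover seat hodgecm-mathlib-K2E3-p17 (g6), Track B «K2-LIT» ∕ h413
(`stmt-HodgeConjecture-24833`), line `K2_E3_EllipticInputs`, unit U12 §L, Richardson road for (LBGL-ge3) at `N = 3` (road owner K2E3-p11),
brick (F-J) = (S-B♭)_Lie, FILE F2a «UNIT DIAGONALS: Sarrus over 𝒪, right multiplication by integral diagonal units, and the `Y`-sections `K_k · diagonal u`».  2026-09-04.
-/
import Summits.HodgeConjecture.HodgeConjecture.Theorems.K2E3GL3ULDChart                   -- ★ p857680 (this seat, F1): ULD chart; brings ★ E2 `addEquivAddHaarChar_scaling` and the R1 imports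
import HarnessLib

/-!
# K2_E3 road (h413), §L ∕ Richardson road at `N = 3`, brick (F-J) FILE F2a: unit diagonals in `GL₃(𝒪)` — `‖det‖ = 1 ↔ unit diagonal` on `{off-diag ∈ 𝔭}`,
# `Y ↦ Y · diagonal u` preserves `μ𝔤` for integral units `u`, and the `Y`-sections of the averaging integrand of FILE F2b

Cell `pub/hodgecm-mathlib` (D-0151), Track B, seat K2E3-p17 (g6), deal (D60) = (F-J) (road owner K2E3-p11; census `K2/K2E3-p17/g6/CENSUS-SBflatLie-N3.K2E3-p17-g6.md` §1 (iv),
brick F, part a).  `--supports stmt-HodgeConjecture-24833 --as helper`; THEOREMS ONLY (no definition ∕ instance ∕ notation ∕ named fact ∕ `sorry`); never imports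
`Cruxes/…/Lines`.  COUNT-NEUTRAL.
* §1 `normAbs_det_eq_one_iff_diag` — for `Y` with integral entries and off-diagonal entries in `𝔭`: `‖det Y‖_F = 1 ↔ ∀ i, ‖Y_ii‖_F = 1` (Sarrus + the strong triangle inequality);
* §2 `map_mul_diagonal_eq_self` — `Y ↦ Y · diagonal u` preserves every additive Haar measure of `M₃(F)` when all `‖u_j‖_F = 1` (entrywise scaling, Haar character `1` by ★ E2);
* §3 `section_eq_image_of_units` ∕ `section_eq_empty_of_not_units` — the `Y`-sections `{Y ∈ M₃(𝒪) : ‖det Y‖ = 1, off-diag ∈ 𝔭^k, u − diag Y ∈ (𝔭^k)³}` are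
  `K_k · diagonal u` for a unit `u` and EMPTY otherwise (`K_k = 1 + M₃(𝔭^k)`, `k ≥ 1`) — the set-theoretic input of the AVERAGING identity of FILE F2b (IMF).
[WeilBNT1967, Ch. I §2, II §2] [BernsteinZelevinsky1976, §3]
HONEST LABEL: HC_CM is proved only modulo the 7 printed citations (2 remaining named inputs: hLiu418 = stmt-HodgeConjecture-24832, h413 = stmt-HodgeConjecture-24833)
until rung 0 closes; count-neutral helper ((LBGL-ge3)∕(LBGL-3J) NOT ★ here).

## References
* [WeilBNT1967] A. Weil, *Basic Number Theory* (1967), Ch. I §2, Ch. II §2.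
* [BernsteinZelevinsky1976] I. N. Bernstein, A. V. Zelevinsky, *Representations of the group GL(n,F)*, Russian Math. Surveys 31:3 (1976), §3.
-/

set_option autoImplicit false
set_option linter.dupNamespace false

noncomputable section

open MeasureTheory Measure Filter Topology Set Matrix ValuativeRel
open scoped MatrixGroups NNReal ENNReal Pointwise Valued
open Literature.NumberTheory.Automorphic Literature.NumberTheory.Automorphic.LocalFieldHaar
open Literature.NumberTheory.GaloisRepresentations Literature.NumberTheory.GaloisRepresentations.IsNonarchimedeanLocalField
open Summit.HodgeConjecture.HodgeConjecture.Cruxes.H413.K2E3GLnMaximalParabolicDescent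
open Summit.HodgeConjecture.HodgeConjecture.Cruxes.H413.K2E3GL3RegularDiagonalOrbitChart

namespace Summit.HodgeConjecture.HodgeConjecture.Cruxes.H413.K2E3GL3DiagonalUnitSections

variable {F : Type*} [Field F] [ValuativeRel F] [TopologicalSpace F] [IsNonarchimedeanLocalField F]

/-! ## §1  Units and the determinant: on `{entries ∈ 𝒪, off-diag ∈ 𝔭}` one has `‖det Y‖ = 1 ↔ ∀ i, ‖Y_ii‖ = 1` -/

/-- A product of three elements of norm `≤ 1` has norm `1` iff each factor has. [folklore] -/
theorem normAbs_mul_three_eq_one_iff {a b c : F} (ha : normAbs F a ≤ 1) (hb : normAbs F b ≤ 1) (hc : normAbs F c ≤ 1) :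
    normAbs F (a * b * c) = 1 ↔ normAbs F a = 1 ∧ normAbs F b = 1 ∧ normAbs F c = 1 := by
  rw [map_mul, map_mul]
  constructor
  · intro h
    have hab : normAbs F a * normAbs F b ≤ 1 := mul_le_one' ha hb
    have h1 : normAbs F a * normAbs F b = 1 ∧ normAbs F c = 1 := by
      by_contra hcon
      rcases not_and_or.1 hcon with h2 | h2
      · exact absurd h (ne_of_lt (by calc normAbs F a * normAbs F b * normAbs F c ≤ normAbs F a * normAbs F b * 1 := by gcongr
            _ < 1 := by rw [mul_one]; exact lt_of_le_of_ne hab h2))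
      · exact absurd h (ne_of_lt (by calc normAbs F a * normAbs F b * normAbs F c ≤ 1 * normAbs F c := by gcongr
            _ < 1 := by rw [one_mul]; exact lt_of_le_of_ne hc h2))
    obtain ⟨hab1, hc1⟩ := h1
    have h2 : normAbs F a = 1 ∧ normAbs F b = 1 := by
      by_contra hcon
      rcases not_and_or.1 hcon with h3 | h3
      · exact absurd hab1 (ne_of_lt (by calc normAbs F a * normAbs F b ≤ normAbs F a * 1 := by gcongr
            _ < 1 := by rw [mul_one]; exact lt_of_le_of_ne ha h3))
      · exact absurd hab1 (ne_of_lt (by calc normAbs F a * normAbs F b ≤ 1 * normAbs F b := by gcongr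
            _ < 1 := by rw [one_mul]; exact lt_of_le_of_ne hb h3))
    exact ⟨h2.1, h2.2, hc1⟩
  · rintro ⟨h1, h2, h3⟩
    rw [h1, h2, h3, mul_one, mul_one]

/-- A product of three integral elements one of which lies in `𝔭` has norm `< 1`. [folklore] -/
theorem normAbs_mul_three_lt_one {a b c : F} (ha : normAbs F a ≤ 1) (hb : normAbs F b ≤ 1) (hc : normAbs F c < 1) :
    normAbs F (a * b * c) < 1 := by
  rw [map_mul, map_mul]
  calc normAbs F a * normAbs F b * normAbs F c ≤ 1 * 1 * normAbs F c := by gcongr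
    _ < 1 := by rw [one_mul, one_mul]; exact hc

/-- **Sarrus + the strong triangle inequality**: for `Y` with integral entries and off-diagonal entries in `𝔭`, `‖det Y‖_F = 1 ↔ ∀ i, ‖Y_ii‖_F = 1`.
[cite: WeilBNT1967, Ch. II §2] -/
theorem normAbs_det_eq_one_iff_diag {Y : Matrix (Fin 3) (Fin 3) F} (hint : ∀ i j, normAbs F (Y i j) ≤ 1) (hoff : ∀ i j, i ≠ j → normAbs F (Y i j) < 1) :
    normAbs F Y.det = 1 ↔ ∀ i, normAbs F (Y i i) = 1 := by
  have h01 : (0 : Fin 3) ≠ 1 := by decide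
  have h02 : (0 : Fin 3) ≠ 2 := by decide
  have h12 : (1 : Fin 3) ≠ 2 := by decide
  -- the five non-diagonal Sarrus terms are small
  set s : F := -(Y 0 0 * Y 1 2 * Y 2 1) - Y 0 1 * Y 1 0 * Y 2 2 + Y 0 1 * Y 1 2 * Y 2 0 + Y 0 2 * Y 1 0 * Y 2 1 - Y 0 2 * Y 1 1 * Y 2 0 with hs
  have hdet : Y.det = Y 0 0 * Y 1 1 * Y 2 2 + s := by rw [Matrix.det_fin_three, hs]; ring
  have hsmall : normAbs F s < 1 := by
    have t1 : normAbs F (Y 0 0 * Y 1 2 * Y 2 1) < 1 := normAbs_mul_three_lt_one (hint 0 0) (hint 1 2) (hoff 2 1 h12.symm)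
    have t2 : normAbs F (Y 0 1 * Y 1 0 * Y 2 2) < 1 := by
      rw [mul_comm (Y 0 1 * Y 1 0), ← mul_assoc]; exact normAbs_mul_three_lt_one (hint 2 2) (hint 0 1) (hoff 1 0 h01.symm)
    have t3 : normAbs F (Y 0 1 * Y 1 2 * Y 2 0) < 1 := normAbs_mul_three_lt_one (hint 0 1) (hint 1 2) (hoff 2 0 h02.symm)
    have t4 : normAbs F (Y 0 2 * Y 1 0 * Y 2 1) < 1 := normAbs_mul_three_lt_one (hint 0 2) (hint 1 0) (hoff 2 1 h12.symm)
    have t5 : normAbs F (Y 0 2 * Y 1 1 * Y 2 0) < 1 := normAbs_mul_three_lt_one (hint 0 2) (hint 1 1) (hoff 2 0 h02.symm)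
    have hneg : ∀ x : F, normAbs F (-x) = normAbs F x := normAbs_neg
    have hadd : ∀ {x y : F}, normAbs F x < 1 → normAbs F y < 1 → normAbs F (x + y) < 1 := fun hx hy =>
      (normAbs_add_le_max _ _).trans_lt (max_lt hx hy)
    have hsub : ∀ {x y : F}, normAbs F x < 1 → normAbs F y < 1 → normAbs F (x - y) < 1 := fun hx hy => by
      rw [sub_eq_add_neg]; exact hadd hx (by rw [hneg]; exact hy)
    rw [hs]
    exact hsub (hadd (hadd (hsub (by rw [hneg]; exact t1) t2) t3) t4) t5
  have hP : normAbs F (Y 0 0 * Y 1 1 * Y 2 2) ≤ 1 := by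
    rw [map_mul, map_mul]; exact mul_le_one' (mul_le_one' (hint 0 0) (hint 1 1)) (hint 2 2)
  rw [hdet]
  constructor
  · intro h
    have hP1 : normAbs F (Y 0 0 * Y 1 1 * Y 2 2) = 1 := by
      by_contra hne
      have hlt : normAbs F (Y 0 0 * Y 1 1 * Y 2 2) < 1 := lt_of_le_of_ne hP hne
      have : normAbs F (Y 0 0 * Y 1 1 * Y 2 2 + s) < 1 := (normAbs_add_le_max _ _).trans_lt (max_lt hlt hsmall)
      exact absurd h this.ne
    obtain ⟨h0, h1, h2⟩ := (normAbs_mul_three_eq_one_iff (hint 0 0) (hint 1 1) (hint 2 2)).1 hP1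
    intro i; fin_cases i <;> assumption
  · intro h
    have hP1 : normAbs F (Y 0 0 * Y 1 1 * Y 2 2) = 1 := (normAbs_mul_three_eq_one_iff (hint 0 0) (hint 1 1) (hint 2 2)).2 ⟨h 0, h 1, h 2⟩
    rw [normAbs_add_eq_of_lt (by rw [hP1]; exact hsmall), hP1]

/-! ## §2  Right multiplication by an integral diagonal unit preserves `μ𝔤`; the unit `Y`-sections are `K_k · diagonal u` -/

section Haar

variable [MeasurableSpace F] [BorelSpace F] [MeasurableSpace (Matrix (Fin 3) (Fin 3) F)] [BorelSpace (Matrix (Fin 3) (Fin 3) F)]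

/-- **`Y ↦ Y · diagonal u` preserves every additive Haar measure of `M₃(F)` when all `‖u_j‖_F = 1`** (an entrywise scaling `Y_{ij} ↦ Y_{ij} u_j`, Haar character
`‖∏_{i,j} u_j‖ = 1` by ★ E2 `addEquivAddHaarChar_scaling`). [cite: WeilBNT1967, Ch. I §2] -/
theorem map_mul_diagonal_eq_self (μ𝔤 : Measure (Matrix (Fin 3) (Fin 3) F)) [μ𝔤.IsAddHaarMeasure] (u : Fin 3 → F) (hu : ∀ i, normAbs F (u i) = 1) :
    μ𝔤.map (fun Y : Matrix (Fin 3) (Fin 3) F => Y * Matrix.diagonal u) = μ𝔤 := by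
  haveI : T2Space F := (isLocalField F).toT2Space
  haveI : LocallyCompactSpace F := (isLocalField F).toLocallyCompactSpace
  haveI : SecondCountableTopology F := secondCountableTopology_localField F
  haveI : IsTopologicalRing F := inferInstance
  haveI : LocallyCompactSpace (Matrix (Fin 3) (Fin 3) F) := locallyCompactSpace_matrix (F := F) (m := Fin 3) (n := Fin 3)
  haveI : μ𝔤.Regular := regular_of_isAddHaarMeasure (F := F) μ𝔤
  have hu0 : ∀ j, u j ≠ 0 := fun j h => by have := hu j; rw [h, map_zero] at this; exact zero_ne_one this
  -- the scaling equivalence `e Y = Y · diagonal u`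
  let L : Matrix (Fin 3) (Fin 3) F ≃ₗ[F] Matrix (Fin 3) (Fin 3) F :=
    { toFun := fun Y => Y * Matrix.diagonal u
      invFun := fun Y => Y * Matrix.diagonal (fun j => (u j)⁻¹)
      map_add' := fun X Y => Matrix.add_mul X Y _
      map_smul' := fun a X => Matrix.smul_mul a X _
      left_inv := fun Y => by
        simp only [Matrix.mul_assoc, Matrix.diagonal_mul_diagonal, mul_inv_cancel₀ (hu0 _), Matrix.diagonal_one, Matrix.mul_one]
      right_inv := fun Y => by
        simp only [Matrix.mul_assoc, Matrix.diagonal_mul_diagonal, inv_mul_cancel₀ (hu0 _), Matrix.diagonal_one, Matrix.mul_one] }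
  have hLc : Continuous L := (continuous_id.matrix_mul continuous_const)
  have hLsc : Continuous L.symm := (continuous_id.matrix_mul continuous_const)
  set e : Matrix (Fin 3) (Fin 3) F ≃L[F] Matrix (Fin 3) (Fin 3) F := { L with continuous_toFun := hLc, continuous_invFun := hLsc } with he_def
  have he : ∀ X i j, e X i j = (fun (_ : Fin 3) (j : Fin 3) => u j) i j * X i j := fun X i j => by
    show (X * Matrix.diagonal u) i j = u j * X i j
    rw [Matrix.mul_diagonal, mul_comm]
  have hchar : addEquivAddHaarChar e.toContinuousAddEquiv = 1 := by
    rw [addEquivAddHaarChar_scaling (fun (_ : Fin 3) (j : Fin 3) => u j) (fun _ j => hu0 j) e he, map_prod]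
    simp only [map_prod, hu, Finset.prod_const_one]
  have hmap : μ𝔤.map (e : Matrix (Fin 3) (Fin 3) F → Matrix (Fin 3) (Fin 3) F) = (addEquivAddHaarChar e.toContinuousAddEquiv)⁻¹ • μ𝔤 := by
    rw [← ContinuousLinearEquiv.toContinuousAddEquiv_coe]
    exact Literature.MeasureTheory.Group.map_eq_addEquivAddHaarChar_inv_smul μ𝔤 e.toContinuousAddEquiv
  rw [hchar, inv_one, one_smul] at hmap
  exact hmap

end Haar


/-! ## §3  The `Y`-sections of the averaging integrand: at a unit `u` the section is `K_k · diagonal u`, at a non-unit `u` it is empty -/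

section Sections

/-- Membership facts for `Y ∈ K_k = 1 + M₃(𝔭^k)` (`k ≥ 1`): integral entries, unit diagonal, off-diagonal in `𝔭^k ⊆ 𝔭`, unit determinant. [folklore] -/
theorem facts_of_mem_congruence {k : ℕ} (hk : 1 ≤ k) {Y : Matrix (Fin 3) (Fin 3) F} (hY : ∀ i j, (Y - 1) i j ∈ primePowBall F k) :
    (∀ i j, normAbs F (Y i j) ≤ 1) ∧ (∀ i, normAbs F (Y i i) = 1) ∧ (∀ i j, i ≠ j → Y i j ∈ primePowBall F k) ∧ normAbs F Y.det = 1 := by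
  have hq1 : ((residueFieldCard F : ℝ≥0)⁻¹) ^ (k : ℤ) < 1 := by
    rw [zpow_natCast]
    exact pow_lt_one₀ (by simp) (inv_lt_one_of_one_lt₀ (by exact_mod_cast one_lt_residueFieldCard F)) (by omega)
  have hlt : ∀ i j, normAbs F ((Y - 1) i j) < 1 := fun i j => (mem_primePowBall_iff.1 (hY i j)).trans_lt hq1
  have hoff : ∀ i j, i ≠ j → Y i j ∈ primePowBall F k := fun i j hij => by
    have h := hY i j; rwa [Matrix.sub_apply, Matrix.one_apply_ne hij, sub_zero] at h
  have hdiag : ∀ i, normAbs F (Y i i) = 1 := fun i => by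
    have h := hlt i i
    rw [Matrix.sub_apply, Matrix.one_apply_eq] at h
    have h2 : Y i i = 1 + (Y i i - 1) := by ring
    rw [h2, normAbs_add_eq_of_lt (by rw [map_one]; exact h), map_one]
  have hint : ∀ i j, normAbs F (Y i j) ≤ 1 := fun i j => by
    by_cases hij : i = j
    · subst hij; exact (hdiag i).le
    · exact ((mem_primePowBall_iff.1 (hoff i j hij)).trans hq1.le)
  exact ⟨hint, hdiag, hoff, (normAbs_det_eq_one_iff_diag hint (fun i j hij => (mem_primePowBall_iff.1 (hoff i j hij)).trans_lt hq1)).2 hdiag⟩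

/-- **The `Y`-section at a UNIT `u` is `K_k · diagonal u`**: for `k ≥ 1` and `‖u_i‖_F = 1`,
`{Y ∈ M₃(𝒪) : ‖det Y‖ = 1, off-diag ∈ 𝔭^k, u − diag Y ∈ (𝔭^k)³} = (· · diagonal u) '' K_k`. [cite: BernsteinZelevinsky1976, §3] -/
theorem section_eq_image_of_units {k : ℕ} (hk : 1 ≤ k) {u : Fin 3 → F} (hu : ∀ i, normAbs F (u i) = 1) :
    ({Y : Matrix (Fin 3) (Fin 3) F | (∀ i j, Y i j ∈ 𝒪[F]) ∧ normAbs F Y.det = 1} ∩ {Y | ∀ i j, i ≠ j → Y i j ∈ primePowBall F k} ∩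
        {Y | (u - fun i => Y i i) ∈ Set.univ.pi fun _ : Fin 3 => primePowBall F k}) =
      (fun Y' : Matrix (Fin 3) (Fin 3) F => Y' * Matrix.diagonal u) '' {Y' : Matrix (Fin 3) (Fin 3) F | ∀ i j, (Y' - 1) i j ∈ primePowBall F k} := by
  have hu0 : ∀ j, u j ≠ 0 := fun j h => by have := hu j; rw [h, map_zero] at this; exact zero_ne_one this
  have hmulu : ∀ {x : F} (j : Fin 3), x ∈ primePowBall F k → x * u j ∈ primePowBall F k := fun {x} j hx => by
    rw [mem_primePowBall_iff, map_mul, hu j, mul_one]; exact mem_primePowBall_iff.1 hx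
  have hmului : ∀ {x : F} (j : Fin 3), x ∈ primePowBall F k → x * (u j)⁻¹ ∈ primePowBall F k := fun {x} j hx => by
    rw [mem_primePowBall_iff, map_mul, map_inv₀, hu j, inv_one, mul_one]; exact mem_primePowBall_iff.1 hx
  ext Y
  simp only [Set.mem_inter_iff, Set.mem_setOf_eq, Set.mem_image, Set.mem_univ_pi, Pi.sub_apply]
  constructor
  · rintro ⟨⟨-, hoff⟩, hdiag⟩
    refine ⟨Y * Matrix.diagonal (fun j => (u j)⁻¹), fun i j => ?_, ?_⟩
    · rw [Matrix.sub_apply, Matrix.mul_diagonal]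
      by_cases hij : i = j
      · subst hij
        rw [Matrix.one_apply_eq]
        have h : Y i i * (u i)⁻¹ - 1 = -((u i - Y i i) * (u i)⁻¹) := by field_simp [hu0 i]; ring
        rw [h]
        exact neg_mem_primePowBall (hmului i (hdiag i))
      · rw [Matrix.one_apply_ne hij, sub_zero]
        exact hmului j (hoff i j hij)
    · rw [Matrix.mul_assoc, Matrix.diagonal_mul_diagonal]
      have h1 : (Matrix.diagonal fun j => (u j)⁻¹ * u j) = (1 : Matrix (Fin 3) (Fin 3) F) := by
        rw [← Matrix.diagonal_one]; congr 1; funext j; exact inv_mul_cancel₀ (hu0 j)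
      rw [h1, Matrix.mul_one]
  · rintro ⟨Y', hY', rfl⟩
    obtain ⟨hint, hdiag, hoff, hdet⟩ := facts_of_mem_congruence hk hY'
    refine ⟨⟨⟨fun i j => ?_, ?_⟩, fun i j hij => ?_⟩, fun i => ?_⟩
    · rw [Matrix.mul_diagonal, ← normAbs_le_one_iff, map_mul, hu j, mul_one]; exact hint i j
    · rw [Matrix.det_mul, Matrix.det_diagonal, map_mul, hdet, one_mul, map_prod]
      simp only [hu, Finset.prod_const_one]
    · rw [Matrix.mul_diagonal]; exact hmulu j (hoff i j hij)
    · rw [Matrix.mul_diagonal]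
      have h : u i - Y' i i * u i = -((Y' - 1) i i * u i) := by rw [Matrix.sub_apply, Matrix.one_apply_eq]; ring
      rw [h]; exact neg_mem_primePowBall (hmulu i (hY' i i))

/-- **The `Y`-section at a NON-UNIT `u` is empty** (`k ≥ 1`): `‖Y_ii‖ = 1` on the set, and `Y_ii − u_i ∈ 𝔭` forces `‖u_i‖ = 1`. [folklore] -/
theorem section_eq_empty_of_not_units {k : ℕ} (hk : 1 ≤ k) {u : Fin 3 → F} (hu : ¬ ∀ i, normAbs F (u i) = 1) :
    ({Y : Matrix (Fin 3) (Fin 3) F | (∀ i j, Y i j ∈ 𝒪[F]) ∧ normAbs F Y.det = 1} ∩ {Y | ∀ i j, i ≠ j → Y i j ∈ primePowBall F k} ∩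
        {Y | (u - fun i => Y i i) ∈ Set.univ.pi fun _ : Fin 3 => primePowBall F k}) = ∅ := by
  have hq1 : ((residueFieldCard F : ℝ≥0)⁻¹) ^ (k : ℤ) < 1 := by
    rw [zpow_natCast]
    exact pow_lt_one₀ (by simp) (inv_lt_one_of_one_lt₀ (by exact_mod_cast one_lt_residueFieldCard F)) (by omega)
  ext Y
  simp only [Set.mem_inter_iff, Set.mem_setOf_eq, Set.mem_univ_pi, Pi.sub_apply, Set.mem_empty_iff_false, iff_false, not_and]
  intro hK hdiag
  apply hu
  have hint : ∀ i j, normAbs F (Y i j) ≤ 1 := fun i j => normAbs_le_one_iff.2 (hK.1.1 i j)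
  have hunit := (normAbs_det_eq_one_iff_diag hint (fun i j hij => (mem_primePowBall_iff.1 (hK.2 i j hij)).trans_lt hq1)).1 hK.1.2
  intro i
  have h : u i = Y i i + (u i - Y i i) := by ring
  rw [h, normAbs_add_eq_of_lt (by rw [hunit i]; exact (mem_primePowBall_iff.1 (hdiag i)).trans_lt hq1), hunit i]

end Sections


end Summit.HodgeConjecture.HodgeConjecture.Cruxes.H413.K2E3GL3DiagonalUnitSections

end
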